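import Literature.Computability.Cryptography.ChenQuantumLWEAdaptiveNonDemolition

/-!
# The `Q` twins of a knowable coset and the `1/Q` bound for any transcript-computed kick (T4, adaptive form, counting version)

REPRODUCTION / ANALYSIS OF A CLAIMED RESULT UNDER ADJUDICATION (withdrawn): Yilei Chen, *Quantum
Algorithms for Lattice Problems*, IACR ePrint 2024/555, version of 2024-04-18 [ChenQuantumLattice2024]
(the version carrying the author's note that Step 9 contains a bug), Step 9 (§3.5.9, pp. 34–38) acting
on the line ket `|φ8.b⟩ = |φ_{b,v′}⟩` (p. 35), the kick of §3.5 (p. 22) and Claim 3.14 (pp. 33–34).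
Bundle `papers/QuantumAdvantage/lwe-quantum-autopsy/`, Part 2 (`REPAIR-CENSUS.md` §1 **T4**, §14.1 (γ),
`REFEREE.md` N-20.1), sequel of `ChenQuantumLWEAdaptiveNonDemolition.lean`.
HONEST FRAMING: kernel-checked THEOREMS about states occurring in a WITHDRAWN algorithm — the counting
form of a NO-GO for in-run repairs of Step 9, NOT summit progress, no cryptanalytic claim in either
direction, no new algorithm; quantum lower bounds are out of scope.

## What is proved

`AdaptiveSafe.kick_wrong_on_a_twin` (previous module) says: for the two instances `v′` and `v′ + d(a,0)`
of one knowable coset, every outcome history of a safe adaptive protocol has the same Born weight, and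
any guess for the centre computed from the history is wrong on at least one of the two.  The referee
(N-20.1) asked for the quantitative form covering RANDOMISED guessing rules.  This module proves it.

* `toP_centreShift_zero`, `eq_of_p₁_Dsq_mul_eq`, **`centreShift_correct_unique`**,
  `card_centreShift_correct_le_one`: for `gcd(D,Q) = 1`, `0 ∉ U`, `bk₀ = −1` and `2D²` a unit mod `P`
  the `Q` instances `T_a := v′ + d(a,0)`, `a ∈ ℤ_Q` — all in the knowable coset of `v′`
  (`sameCoset_centreShift`) — have PAIRWISE DISTINCT centres mod `P` (`a ↦ D²p₁a mod P` is injective on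
  `ℤ_Q`), so a single guess `w0 ∈ ℤ_N` has centre error `0` on AT MOST ONE of them.
* `guessSucc step T μ g b w`: the success weight, on the instance `(b, w)`, of "run the protocol for `T`
  stages, then guess the centre by the randomised rule `g : history → coin → ℤ_N` with coin weights `μ`":
  `Σ_{h ∈ K^T} Σ_ω μ(ω) · histProb step h |φ_{b,w}⟩ · [centre error of g(h,ω) on w is 0]`.
* **`AdaptiveSafe.sum_guessSucc_le_mass`**, **`AdaptiveSafe.sum_guessSucc_le`**: for a safe adaptive
  protocol (odd `P`, odd `Q`, `gcd(p₁,Q) = 1`, `gcd(D,Q) = 1`, `0 ∉ U ≠ ∅`, `bk₀ = −1`, `2D²` a unit mod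
  `P`) and non-negative coin weights of total mass `1`, the success weights of the `Q` twins SUM to at
  most the total mass `Σ_h p(h)` of the transcript law on the true instance — hence to at most `1` when
  that law is sub-normalised (automatic for instruments; an explicit hypothesis because completeness is
  never assumed in this series).  Proof: the transcript law is the same on every twin
  (`AdaptiveSafe.histProb_indep`), so the sum is
  `Σ_h Σ_ω p(h) μ(ω) · #{a : g(h,ω) correct on T_a} ≤ Σ_h p(h) · Σ_ω μ(ω) = Σ_h p(h)`.
* **`AdaptiveSafe.exists_guessSucc_le_inv_Q`**: hence SOME twin `T_a` — an instance the algorithm cannot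
  distinguish from the true one by anything it knows or has observed — has success weight `≤ 1/Q`:
  no rule, deterministic or randomised, beats the blind guess among the `Q` admissible centre residues,
  uniformly over the knowable coset.  `Shape.adaptive_guess_le_inv_Q` discharges the standing
  hypotheses from Chen's admissible parameters (Conditions C.1–C.7).

References: [ChenQuantumLattice2024] Y. Chen, *Quantum Algorithms for Lattice Problems*, IACR ePrint
2024/555 (2024), withdrawn 2024-04-18, §3.5 p. 22, §3.5.9 pp. 34–38, Claim 3.14 pp. 33–34.
-/

namespace Literature.Computability.Cryptography.Chen2024

open scoped BigOperators

/-! ### The `Q` twins have pairwise distinct centres -/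

section Twins

variable (n : ℕ) (D p₁ Q : ℕ+)

/-- The centre residue of the twin `v′ + d(a,0)`: `(v′ + d(a,0))₀ ≡ v′₀ − p₁·D²·a (mod P)`.
[cite: ChenQuantumLattice2024, Claim 3.14 pp. 33–34, §3.5.9 p. 35] -/
theorem toP_centreShift_zero {U : Finset (Fin (n + 1))} (hU : (0 : Fin (n + 1)) ∉ U)
    {bk : Fin (n + 1) → ℤ} (hbk0 : bk 0 = -1) (v' : Fin (n + 1) → ℤ) (a : ZQ Q) :
    toP D (p₁ * Q) (((centreShift n D p₁ Q U bk v' a 0 : ℤ) : ZN D p₁ Q))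
      = toP D (p₁ * Q) (((v' 0 : ℤ) : ZN D p₁ Q))
        - ((p₁ : ℕ) : ZP p₁ Q) * ((((D : ℕ) : ZP p₁ Q)) ^ 2 * ((a.val : ℕ) : ZP p₁ Q)) := by
  rw [map_intCast, map_intCast, centreShift_zero n D p₁ Q hU hbk0]
  simp only [Int.cast_sub, Int.cast_mul, Int.cast_pow, Int.cast_natCast]
  ring

variable {n}

/-- `a ↦ p₁·D²·a (mod P)` is injective on `ℤ_Q` when `gcd(D,Q) = 1` (`P = p₁Q`). [folklore] -/
theorem eq_of_p₁_Dsq_mul_eq (hDQ : Nat.Coprime (D : ℕ) (Q : ℕ)) {a a' : ZQ Q}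
    (h : ((p₁ : ℕ) : ZP p₁ Q) * ((((D : ℕ) : ZP p₁ Q)) ^ 2 * ((a.val : ℕ) : ZP p₁ Q))
        = ((p₁ : ℕ) : ZP p₁ Q) * ((((D : ℕ) : ZP p₁ Q)) ^ 2 * ((a'.val : ℕ) : ZP p₁ Q))) :
    a = a' := by
  have h2 : ((p₁ : ℕ) : ZP p₁ Q)
      * ((((D : ℕ) : ZP p₁ Q)) ^ 2 * (((a.val : ℕ) : ZP p₁ Q) - ((a'.val : ℕ) : ZP p₁ Q))) = 0 := by
    rw [mul_sub, mul_sub, h, sub_self]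
  rw [p₁_mul_eq_zero_iff p₁ Q, map_mul, map_sub, map_pow, map_natCast, map_natCast, map_natCast,
    ZMod.natCast_zmod_val, ZMod.natCast_zmod_val] at h2
  have hu : IsUnit ((((D : ℕ) : ZQ Q)) ^ 2) := ((ZMod.isUnit_iff_coprime _ _).2 hDQ).pow 2
  exact sub_eq_zero.1 (hu.mul_right_eq_zero.1 h2)

variable (n)

/-- **At most one twin is hit.**  For `gcd(D,Q) = 1`, `0 ∉ U`, `bk₀ = −1`, `2D²` a unit mod `P`: if a
guess `w0 ∈ ℤ_N` has centre error `0` on `v′ + d(a,0)` and on `v′ + d(a′,0)` then `a = a′` — the `Q`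
twins of the knowable coset have pairwise distinct centres mod `P`.
[cite: ChenQuantumLattice2024, §3.5 p. 22, §3.5.9 p. 35, Claim 3.14 pp. 33–34] -/
theorem centreShift_correct_unique (hDQ : Nat.Coprime (D : ℕ) (Q : ℕ)) {U : Finset (Fin (n + 1))}
    (hU : (0 : Fin (n + 1)) ∉ U) {bk : Fin (n + 1) → ℤ} (hbk0 : bk 0 = -1) (v' : Fin (n + 1) → ℤ)
    (hunit : IsUnit ((2 * D * D : ℕ) : ZP p₁ Q)) (w0 : ZN D p₁ Q) {a a' : ZQ Q}
    (ha : centreError n D p₁ Q (centreShift n D p₁ Q U bk v' a) w0 = 0)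
    (ha' : centreError n D p₁ Q (centreShift n D p₁ Q U bk v' a') w0 = 0) : a = a' := by
  rw [centreError_eq_zero_iff n D p₁ Q _ hunit] at ha ha'
  have h3 := ha.symm.trans ha'
  rw [toP_centreShift_zero n D p₁ Q hU hbk0, toP_centreShift_zero n D p₁ Q hU hbk0, sub_right_inj] at h3
  exact eq_of_p₁_Dsq_mul_eq D p₁ Q hDQ h3

/-- Counting form: the set of twins on which a given guess is right has at most one element. [folklore] -/
theorem card_centreShift_correct_le_one (hDQ : Nat.Coprime (D : ℕ) (Q : ℕ)) {U : Finset (Fin (n + 1))}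
    (hU : (0 : Fin (n + 1)) ∉ U) {bk : Fin (n + 1) → ℤ} (hbk0 : bk 0 = -1) (v' : Fin (n + 1) → ℤ)
    (hunit : IsUnit ((2 * D * D : ℕ) : ZP p₁ Q)) (w0 : ZN D p₁ Q) :
    (Finset.univ.filter fun a : ZQ Q =>
        centreError n D p₁ Q (centreShift n D p₁ Q U bk v' a) w0 = 0).card ≤ 1 :=
  Finset.card_le_one.2 fun _ ha _ ha' =>
    centreShift_correct_unique n D p₁ Q hDQ hU hbk0 v' hunit w0 (Finset.mem_filter.1 ha).2
      (Finset.mem_filter.1 ha').2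

end Twins

/-! ### Success weights of a randomised transcript-computed guess -/

section Guess

variable (n : ℕ) (D p₁ Q : ℕ+)

/-- The SUCCESS WEIGHT on the instance `(b, w)` of: run the adaptive protocol `step` for `T` stages,
then guess the centre by the randomised rule `g` (history and coin `ω ↦` a guess `w0 ∈ ℤ_N`) with coin
weights `μ`; success = centre error `0` (`centreError_eq_zero_iff`: the kick is then the
chirp-cancelling one Step 9 needs).  Unnormalised Born weights (`histProb`); no completeness assumed.
[cite: ChenQuantumLattice2024, §3.5 p. 22, §3.5.9 pp. 34–38] -/
noncomputable def guessSucc {K Ω : Type*} [Fintype K] [Fintype Ω]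
    (step : List K → K →
      (Ket (n + 1) ((D * D * (p₁ * Q) : ℕ+) : ℕ) →ₗ[ℂ] Ket (n + 1) ((D * D * (p₁ * Q) : ℕ+) : ℕ)))
    (T : ℕ) (μ : Ω → ℝ) (g : List K → Ω → ZN D p₁ Q) (b w : Fin (n + 1) → ℤ) : ℝ :=
  ∑ h : List.Vector K T, ∑ ω : Ω,
    μ ω * histProb step h.toList (phi8bKet n D p₁ Q b w)
      * (if centreError n D p₁ Q w (g h.toList ω) = 0 then 1 else 0)

variable {n D p₁ Q}

/-- Born weights of histories are non-negative. [folklore] -/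
theorem histProb_nonneg {k m : ℕ} [NeZero m] {K : Type*}
    (step : List K → K → (Ket k m →ₗ[ℂ] Ket k m)) (h : List K) (ψ : Ket k m) :
    0 ≤ histProb step h ψ :=
  div_nonneg (Finset.sum_nonneg fun u _ => weight_nonneg' _ u)
    (Finset.sum_nonneg fun u _ => weight_nonneg' _ u)

variable {K Ω : Type*} [Fintype K] [Fintype Ω] {U : Finset (Fin (n + 1))} {bk v' : Fin (n + 1) → ℤ}
variable {step : List K → K →
  (Ket (n + 1) ((D * D * (p₁ * Q) : ℕ+) : ℕ) →ₗ[ℂ] Ket (n + 1) ((D * D * (p₁ * Q) : ℕ+) : ℕ))}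

/-- Success weights are non-negative (for non-negative coin weights). [folklore] -/
theorem guessSucc_nonneg (T : ℕ) {μ : Ω → ℝ} (hμ : ∀ ω, 0 ≤ μ ω) (g : List K → Ω → ZN D p₁ Q)
    (b w : Fin (n + 1) → ℤ) : 0 ≤ guessSucc n D p₁ Q step T μ g b w := by
  refine Finset.sum_nonneg fun h _ => Finset.sum_nonneg fun ω _ => ?_
  refine mul_nonneg (mul_nonneg (hμ ω) (histProb_nonneg step _ _)) ?_
  split_ifs <;> norm_num

/-- **The success weights of the `Q` twins sum to at most the mass of the transcript law.**  For a
safe adaptive protocol (odd `P`, odd `Q`, `gcd(p₁,Q) = 1`, `gcd(D,Q) = 1`, `0 ∉ U ≠ ∅`, `bk₀ = −1`, `2D²`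
a unit mod `P`), any number of stages `T` and any randomised guessing rule `g` with non-negative coin
weights of mass `1`: `Σ_{a ∈ ℤ_Q} guessSucc(b, v′ + d(a,0)) ≤ Σ_h histProb h |φ_{b,v′}⟩`.  (The transcript
law is the same on all `Q` twins by `AdaptiveSafe.histProb_indep`, and each single guess is right on at
most one twin by `card_centreShift_correct_le_one`.)  No completeness is assumed.
[cite: ChenQuantumLattice2024, §3.5 p. 22, §3.5.9 pp. 34–38, Claim 3.14 pp. 33–34] -/
theorem AdaptiveSafe.sum_guessSucc_le_mass (hS : AdaptiveSafe n D p₁ Q U bk v' step)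
    (hP : Odd ((p₁ * Q : ℕ+) : ℕ)) (hQ : Odd ((Q : ℕ+) : ℕ)) (hpQ : Nat.Coprime (p₁ : ℕ) (Q : ℕ))
    (hDQ : Nat.Coprime (D : ℕ) (Q : ℕ)) (hU : (0 : Fin (n + 1)) ∉ U) (hU' : U.Nonempty)
    (hbk0 : bk 0 = -1) (hunit : IsUnit ((2 * D * D : ℕ) : ZP p₁ Q)) {b : Fin (n + 1) → ℤ}
    (hb : InClass n p₁ U bk b) (T : ℕ) {μ : Ω → ℝ} (hμ : ∀ ω, 0 ≤ μ ω) (hμ1 : ∑ ω, μ ω = 1)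
    (g : List K → Ω → ZN D p₁ Q) :
    ∑ a : ZQ Q, guessSucc n D p₁ Q step T μ g b (centreShift n D p₁ Q U bk v' a)
      ≤ ∑ h : List.Vector K T, histProb step h.toList (phi8bKet n D p₁ Q b v') := by
  classical
  -- the transcript law is the same on every twin
  have hlaw : ∀ (a : ZQ Q) (h : List.Vector K T),
      histProb step h.toList (phi8bKet n D p₁ Q b (centreShift n D p₁ Q U bk v' a))
        = histProb step h.toList (phi8bKet n D p₁ Q b v') := fun a h =>
    hS.histProb_indep hP hQ hpQ hU hU' hbk0 h.toList hb (sameCoset_centreShift n D p₁ Q U bk v' a)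
      hb (sameCoset_refl v')
  -- rewrite the success weights with the common law and swap the sums
  have hrw : ∀ a : ZQ Q, guessSucc n D p₁ Q step T μ g b (centreShift n D p₁ Q U bk v' a)
      = ∑ h : List.Vector K T, ∑ ω : Ω, μ ω * histProb step h.toList (phi8bKet n D p₁ Q b v')
          * (if centreError n D p₁ Q (centreShift n D p₁ Q U bk v' a) (g h.toList ω) = 0
              then 1 else 0) := by
    intro a
    simp only [guessSucc, hlaw a]
  simp_rw [hrw]
  rw [Finset.sum_comm]
  refine Finset.sum_le_sum fun h _ => ?_
  rw [Finset.sum_comm]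
  -- for each coin value, at most one twin is hit
  have hω : ∀ ω : Ω, ∑ a : ZQ Q, μ ω * histProb step h.toList (phi8bKet n D p₁ Q b v')
      * (if centreError n D p₁ Q (centreShift n D p₁ Q U bk v' a) (g h.toList ω) = 0
          then (1 : ℝ) else 0)
      ≤ μ ω * histProb step h.toList (phi8bKet n D p₁ Q b v') := by
    intro ω
    rw [← Finset.mul_sum, Finset.sum_boole]
    have hc := card_centreShift_correct_le_one n D p₁ Q hDQ hU hbk0 v' hunit (g h.toList ω)
    have hc' : (((Finset.univ.filter fun a : ZQ Q =>
        centreError n D p₁ Q (centreShift n D p₁ Q U bk v' a) (g h.toList ω) = 0).card : ℕ) : ℝ)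
        ≤ 1 := by exact_mod_cast hc
    have h0 : 0 ≤ μ ω * histProb step h.toList (phi8bKet n D p₁ Q b v') :=
      mul_nonneg (hμ ω) (histProb_nonneg step _ _)
    calc μ ω * histProb step h.toList (phi8bKet n D p₁ Q b v') * _
        ≤ μ ω * histProb step h.toList (phi8bKet n D p₁ Q b v') * 1 :=
          mul_le_mul_of_nonneg_left hc' h0
      _ = _ := mul_one _
  calc ∑ ω : Ω, ∑ a : ZQ Q, μ ω * histProb step h.toList (phi8bKet n D p₁ Q b v')
          * (if centreError n D p₁ Q (centreShift n D p₁ Q U bk v' a) (g h.toList ω) = 0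
              then (1 : ℝ) else 0)
      ≤ ∑ ω : Ω, μ ω * histProb step h.toList (phi8bKet n D p₁ Q b v') := Finset.sum_le_sum fun ω _ => hω ω
    _ = histProb step h.toList (phi8bKet n D p₁ Q b v') := by
      rw [← Finset.sum_mul, hμ1, one_mul]

/-- **The success weights of the `Q` twins sum to at most `1`** when, in addition, the transcript law
has total mass `≤ 1` on the true instance `(b, v′)` (sub-normalisation — automatic for instruments; an
explicit hypothesis here because completeness is never assumed in this series; for a post-selected
protocol read all weights conditionally on acceptance).
[cite: ChenQuantumLattice2024, §3.5 p. 22, §3.5.9 pp. 34–38, Claim 3.14 pp. 33–34] -/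
theorem AdaptiveSafe.sum_guessSucc_le (hS : AdaptiveSafe n D p₁ Q U bk v' step)
    (hP : Odd ((p₁ * Q : ℕ+) : ℕ)) (hQ : Odd ((Q : ℕ+) : ℕ)) (hpQ : Nat.Coprime (p₁ : ℕ) (Q : ℕ))
    (hDQ : Nat.Coprime (D : ℕ) (Q : ℕ)) (hU : (0 : Fin (n + 1)) ∉ U) (hU' : U.Nonempty)
    (hbk0 : bk 0 = -1) (hunit : IsUnit ((2 * D * D : ℕ) : ZP p₁ Q)) {b : Fin (n + 1) → ℤ}
    (hb : InClass n p₁ U bk b) (T : ℕ) {μ : Ω → ℝ} (hμ : ∀ ω, 0 ≤ μ ω) (hμ1 : ∑ ω, μ ω = 1)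
    (g : List K → Ω → ZN D p₁ Q)
    (hnorm : ∑ h : List.Vector K T, histProb step h.toList (phi8bKet n D p₁ Q b v') ≤ 1) :
    ∑ a : ZQ Q, guessSucc n D p₁ Q step T μ g b (centreShift n D p₁ Q U bk v' a) ≤ 1 :=
  (hS.sum_guessSucc_le_mass hP hQ hpQ hDQ hU hU' hbk0 hunit hb T hμ hμ1 g).trans hnorm

/-- **Some twin is guessed with weight at most `1/Q`.**  Under the hypotheses of
`AdaptiveSafe.sum_guessSucc_le` there is an `a ∈ ℤ_Q` — an instance `(b, v′ + d(a,0))` with the same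
class, the same line invariants, the same Step-8 datum and the same transcript law as `(b, v′)` — on
which the protocol-plus-guess supplies the chirp-cancelling kick with total weight `≤ 1/Q`: among the
`Q` admissible centre residues (`centreError_eq_zero_iff`: the residue mod `Q` that Claim 3.14 does not
supply) nothing computed inside the run beats a blind guess, uniformly over the knowable coset.
[cite: ChenQuantumLattice2024, §3.5 p. 22, §3.5.9 pp. 34–38, Claim 3.14 pp. 33–34] -/
theorem AdaptiveSafe.exists_guessSucc_le_inv_Q (hS : AdaptiveSafe n D p₁ Q U bk v' step)
    (hP : Odd ((p₁ * Q : ℕ+) : ℕ)) (hQ : Odd ((Q : ℕ+) : ℕ)) (hpQ : Nat.Coprime (p₁ : ℕ) (Q : ℕ))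
    (hDQ : Nat.Coprime (D : ℕ) (Q : ℕ)) (hU : (0 : Fin (n + 1)) ∉ U) (hU' : U.Nonempty)
    (hbk0 : bk 0 = -1) (hunit : IsUnit ((2 * D * D : ℕ) : ZP p₁ Q)) {b : Fin (n + 1) → ℤ}
    (hb : InClass n p₁ U bk b) (T : ℕ) {μ : Ω → ℝ} (hμ : ∀ ω, 0 ≤ μ ω) (hμ1 : ∑ ω, μ ω = 1)
    (g : List K → Ω → ZN D p₁ Q)
    (hnorm : ∑ h : List.Vector K T, histProb step h.toList (phi8bKet n D p₁ Q b v') ≤ 1) :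
    ∃ a : ZQ Q, guessSucc n D p₁ Q step T μ g b (centreShift n D p₁ Q U bk v' a)
      ≤ 1 / ((Q : ℕ+) : ℕ) := by
  have hsum := hS.sum_guessSucc_le hP hQ hpQ hDQ hU hU' hbk0 hunit hb T hμ hμ1 g hnorm
  have hQpos : (0 : ℝ) < ((Q : ℕ+) : ℕ) := by exact_mod_cast PNat.pos Q
  have hconst : ∑ _a : ZQ Q, (1 / ((Q : ℕ+) : ℕ) : ℝ) = 1 := by
    rw [Finset.sum_const, Finset.card_univ, ZMod.card, nsmul_eq_mul]
    field_simp
  obtain ⟨a, -, ha⟩ := Finset.exists_le_of_sum_le (Finset.univ_nonempty (α := ZQ Q))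
    (f := fun a => guessSucc n D p₁ Q step T μ g b (centreShift n D p₁ Q U bk v' a))
    (g := fun _ => (1 / ((Q : ℕ+) : ℕ) : ℝ)) (by rw [hconst]; exact hsum)
  exact ⟨a, ha⟩

end Guess

/-! ### Instantiation at Chen's admissible parameters -/

namespace Shape

variable (S : Shape)

/-- **At Chen's parameters: no transcript-computed kick beats `1/Q`.**  For an admissible shape, a
safe adaptive protocol on the run's state and any randomised rule turning the observed history into a
guess for the centre: some instance of the knowable coset of the true offset — indistinguishable from it
by class, line invariants, Step-8 datum and transcript — receives the correct kick with weight at most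
`1/Q`. [cite: ChenQuantumLattice2024, §3.5 p. 22, §3.5.9 pp. 34–38, Claim 3.14 pp. 33–34, Cond. C.3 p. 18] -/
theorem adaptive_guess_le_inv_Q (h : S.Admissible) (U : Finset (Fin (S.n + 1)))
    (hU : (0 : Fin (S.n + 1)) ∉ U) (hU' : U.Nonempty) (bk : Fin (S.n + 1) → ℤ)
    (hbk : ∀ i, i ∉ U → bk i = S.b i) {K Ω : Type*} [Fintype K] [Fintype Ω]
    (step : List K → K → (Ket (S.n + 1) ((S.D * S.D * (S.p₁ * S.Q) : ℕ+) : ℕ)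
      →ₗ[ℂ] Ket (S.n + 1) ((S.D * S.D * (S.p₁ * S.Q) : ℕ+) : ℕ)))
    (hS : AdaptiveSafe S.n S.D S.p₁ S.Q U bk S.v' step) (T : ℕ) {μ : Ω → ℝ} (hμ : ∀ ω, 0 ≤ μ ω)
    (hμ1 : ∑ ω, μ ω = 1) (g : List K → Ω → ZN S.D S.p₁ S.Q)
    (hnorm : ∑ hist : List.Vector K T,
      histProb step hist.toList (phi8bKet S.n S.D S.p₁ S.Q S.b S.v') ≤ 1) :
    ∃ a : ZQ S.Q, guessSucc S.n S.D S.p₁ S.Q step T μ g S.b (centreShift S.n S.D S.p₁ S.Q U bk S.v' a)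
      ≤ 1 / ((S.Q : ℕ+) : ℕ) := by
  have hbk0 : bk 0 = -1 := by rw [hbk 0 hU, h.b_head]
  have hSb : InClass S.n S.p₁ U bk S.b :=
    ⟨fun i hi => (hbk i hi).symm, fun i hi => h.b_tail i (fun h0 => hU (h0 ▸ hi))⟩
  exact hS.exists_guessSucc_le_inv_Q h.odd_P h.odd_Q h.cop_pQ h.cop_DQ hU hU' hbk0 h.isUnit_twoDD hSb T
    hμ hμ1 g hnorm

end Shape

end Literature.Computability.Cryptography.Chen2024
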